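import Summits.Ventures.CertifiedManyBodySolver.Upper.IntervalReaderSentence
import Summits.Ventures.CertifiedManyBodySolver.Upper.IntervalReaderBoxEnergy

/-!
# Ventures/CertifiedManyBodySolver — Upper/IntervalReaderBoxKernel.lean: the multi-state route for the `t–t′` BOX class
(part 18 of the Theorem-H1′ package; parts 1–17: `IntervalReaderSchur` … `IntervalReaderSentence`)

HONEST FRAMING: first certified bounds; not a superconductivity verdict; every number certified or labelled
float.  Pure algebra (part 15 + part 10's relabelling); no number is certified here, no row moves, nothing is
said about the Hubbard model's spectrum or the thermodynamic limit.

Part 15 proved «E1's automaton represents `hamiltonian G t U`» for graphs ON THE ENUMERATION ORDER `Fin N`.  The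
FORMAT-mps1 rows of record are open `a × b` boxes with nearest (`t`) AND diagonal (`t′`) hopping, whose Hamiltonian
`hubbardOpenBoxTT' a b t t′ U = hamiltonian (rectBoxGraph a b) t U + hamiltonian (rectBoxDiagGraph a b) t′ 0` lives
on `Fin a ×ₗ Fin b` with ITS Lex (= Jordan–Wigner) order, read by the consumer (`Theorems/R2cBoxMpsConsumer`) through
an enumeration `e : Fin (a·b) ≃ Fin a ×ₗ Fin b` as `Ψ k = ψ (k ∘ e)` (part 10).  E1 enumerates column-major = the Lex
order, i.e. `e` is MONOTONE — and for a monotone enumeration the chain's Jordan–Wigner strings ARE the box's.  Hence: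

* `hopFamily_comp_of_strictMono` — for `e` with `e i < e j ↔ i < j`: `hopFamily (e k) (e k′) σ τ ∘ e = hopFamily k k′ σ τ`
  (and the on-site family likewise, `update_comp_equiv`);
* `inner_toSpin_hamiltonian_relabel` — for such `e`, any graph `G` on `Λ` and its pull-back `G′` on `Fin N`
  (`G′.Adj k k′ ↔ G.Adj (e k) (e k′)`): `star Ψ ⬝ᵥ (toSpin (hamiltonian G t U) *ᵥ Ψ′) = star ψ ⬝ᵥ (toSpin (hamiltonian G′ t U) *ᵥ ψ′)`;
* `twoGraphAutomaton G₁ G₂ t t′ U` — E1's automaton with weights `t·[G₁.Adj] + t′·[G₂.Adj]` (E1 merges the `t` and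
  `t′` partners of a mode into ONE channel with per-bond closing weights — exactly `hubbardAutomaton` with this `w`),
  and `automatonKernel_twoGraphAutomaton_eq_toSpin` — its `(START, FINAL)` kernel is
  `toSpin (hamiltonian G₁ t U + hamiltonian G₂ t′ 0)`;
* `colMajorEquiv a b` / `colMajorEquiv_lt_iff` — E1's column-major enumeration `k ↦ (k / b, k % b)` IS monotone (the
  hypothesis `he` below, discharged for E1's order);
* `reader_encloses_boxTT'_element` — END TO END FOR THE BOX CLASS: for a monotone enumeration `e` of the `a × b`
  box and the pulled-back nearest / diagonal graphs `G₁′, G₂′` on `Fin (a·b)`, the reader's number out of the last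
  `FINAL` environment of the sweep over `twoGraphAutomaton G₁′ G₂′ t t′ U` is within the printed radius (times the
  boundary factor) of `star Ψ_l ⬝ᵥ (toSpin (hubbardOpenBoxTT' a b t t′ U) *ᵥ Ψ_{l′})` — the matrix element of the
  consumer's own operator between the consumer's own vectors;
* `boxTT'_sentence_of_reader` — THE BOX CAPSTONE (part 17's `certificate_sentence_of_reader` for the box class): the
  bytes hypotheses of the `H`-sweep over `twoGraphAutomaton G₁′ G₂′ t t′ U` and of the `Nrm`-sweep, plus the reader's
  by-value ACCEPT test, imply `Re (star Ψ ⬝ᵥ (toSpin (hubbardOpenBoxTT' a b t t′ U) *ᵥ Ψ)) ≤ E · Re (star Ψ ⬝ᵥ Ψ)` for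
  `Ψ k = mpsOpenVar (a·b) A l r (k ∘ e)` — literally the hypothesis `hE` of `Theorems/R2cBoxMpsConsumer.lean`
  (part 10's `boxMps_sentence_iff_sweeps` is the same sentence unfolded into sweeps).
-/

noncomputable section

open Matrix Finset WithLp
open scoped BigOperators ComplexOrder Matrix.Norms.L2Operator

namespace Summit.Ventures.CertifiedManyBodySolver.Upper.IntervalReader

open Literature.MathematicalPhysics.QuantumLattice
open Literature.MathematicalPhysics.QuantumLattice.JordanWigner

/-! ## §FF  Monotone relabelling of the Jordan–Wigner words -/

section Relabel

variable {Λ : Type*} [LinearOrder Λ] [Fintype Λ] {N : ℕ}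

omit [Fintype Λ] in
/-- A strictly monotone bijection also preserves `≤`. -/
theorem le_iff_le_of_strictMono_equiv (e : Fin N ≃ Λ) (he : ∀ i j, e i < e j ↔ i < j) (i j : Fin N) :
    e i ≤ e j ↔ i ≤ j := by
  rw [← not_lt, ← not_lt, he]

omit [Fintype Λ] in
/-- **The chain's strings are the box's.**  Along a monotone enumeration the hopping word of the sites `e k, e k′`
read at the enumerated sites is the hopping word of `k, k′` on the chain. -/
theorem hopFamily_comp_of_strictMono (e : Fin N ≃ Λ) (he : ∀ i j, e i < e j ↔ i < j) (k k' : Fin N)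
    (σ τ : Fin 2) : (fun i => hopFamily (e k) (e k') σ τ (e i)) = hopFamily k k' σ τ := by
  funext i
  simp only [hopFamily, Function.update_apply, e.injective.eq_iff, he, le_iff_le_of_strictMono_equiv e he]

omit [LinearOrder Λ] [Fintype Λ] in
/-- On-site words relabel along any bijection. -/
theorem update_comp_equiv [DecidableEq Λ] (e : Fin N ≃ Λ) (k : Fin N) (M : Matrix (Fin 4) (Fin 4) ℂ) :
    (fun i => Function.update (fun _ => (1 : Matrix (Fin 4) (Fin 4) ℂ)) (e k) M (e i)) =
      Function.update (fun _ => (1 : Matrix (Fin 4) (Fin 4) ℂ)) k M := by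
  funext i
  simp only [Function.update_apply, e.injective.eq_iff]

/-- **The Hubbard Hamiltonian commutes with monotone relabelling** (pairing form).  For a monotone enumeration
`e : Fin N ≃ Λ`, a graph `G` on `Λ` and its pull-back `G′` on `Fin N`, and any vectors `ψ, ψ′` on the chain read on the
box as `Ψ k = ψ (k ∘ e)`: `star Ψ ⬝ᵥ (toSpin (hamiltonian G t U) *ᵥ Ψ′) = star ψ ⬝ᵥ (toSpin (hamiltonian G′ t U) *ᵥ ψ′)`. -/
theorem inner_toSpin_hamiltonian_relabel (e : Fin N ≃ Λ) (he : ∀ i j, e i < e j ↔ i < j)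
    (G : SimpleGraph Λ) [DecidableRel G.Adj] (G' : SimpleGraph (Fin N)) [DecidableRel G'.Adj]
    (hG : ∀ k k', G'.Adj k k' ↔ G.Adj (e k) (e k')) (t U : ℝ) (ψ ψ' : TensorIndex (Fin N) 4 → ℂ) :
    star (fun k : TensorIndex Λ 4 => ψ (fun i => k (e i))) ⬝ᵥ
        (toSpin (hamiltonian G t U) *ᵥ fun k : TensorIndex Λ 4 => ψ' (fun i => k (e i))) =
      star ψ ⬝ᵥ (toSpin (hamiltonian G' t U) *ᵥ ψ') := by
  rw [toSpin_hamiltonian_eq_sum_productOp, toSpin_hamiltonian_eq_sum_productOp]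
  simp only [add_mulVec, dotProduct_add, smul_mulVec, dotProduct_smul, Matrix.sum_mulVec, dotProduct_sum]
  congr 2
  · -- hopping words: reindex the site sums along `e`, relabel each word
    rw [← Fintype.sum_equiv e (fun k => ∑ y, ∑ σ : Fin 2,
      star (fun κ : TensorIndex Λ 4 => ψ (fun i => κ (e i))) ⬝ᵥ
        ((if G.Adj (e k) y then productOp (hopFamily (e k) y σ σ) else 0) *ᵥ
          fun κ : TensorIndex Λ 4 => ψ' (fun i => κ (e i)))) _ (fun _ => rfl)]
    refine Finset.sum_congr rfl fun k _ => ?_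
    rw [← Fintype.sum_equiv e (fun k' => ∑ σ : Fin 2,
      star (fun κ : TensorIndex Λ 4 => ψ (fun i => κ (e i))) ⬝ᵥ
        ((if G.Adj (e k) (e k') then productOp (hopFamily (e k) (e k') σ σ) else 0) *ᵥ
          fun κ : TensorIndex Λ 4 => ψ' (fun i => κ (e i)))) _ (fun _ => rfl)]
    refine Finset.sum_congr rfl fun k' _ => Finset.sum_congr rfl fun σ _ => ?_
    by_cases hadj : G.Adj (e k) (e k')
    · rw [if_pos hadj, if_pos ((hG k k').mpr hadj), inner_productOp_compEquiv, hopFamily_comp_of_strictMono e he]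
    · rw [if_neg hadj, if_neg (fun h => hadj ((hG k k').mp h)), zero_mulVec, zero_mulVec, dotProduct_zero,
        dotProduct_zero]
  · -- on-site words
    rw [← Fintype.sum_equiv e (fun k =>
      star (fun κ : TensorIndex Λ 4 => ψ (fun i => κ (e i))) ⬝ᵥ
        (productOp (Function.update (fun _ => (1 : Matrix (Fin 4) (Fin 4) ℂ)) (e k) siteDouble) *ᵥ
          fun κ : TensorIndex Λ 4 => ψ' (fun i => κ (e i)))) _ (fun _ => rfl)]
    refine Finset.sum_congr rfl fun k _ => ?_
    rw [inner_productOp_compEquiv, update_comp_equiv]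

end Relabel

/-! ## §GG  Two graphs (`t–t′`): one automaton, per-bond weights -/

section TwoGraphs

variable {N : ℕ}

/-- E1's automaton for `hamiltonian G₁ t U + hamiltonian G₂ t′ 0` on the enumeration order (nearest-neighbour bonds
weighted `t`, next-nearest `t′`; E1 folds both partner lists of a mode into ONE channel with per-bond closing
weights — `hubbardAutomaton` with `w = t·[G₁.Adj] + t′·[G₂.Adj]`). -/
def twoGraphAutomaton (G₁ G₂ : SimpleGraph (Fin N)) [DecidableRel G₁.Adj] [DecidableRel G₂.Adj] (t t' U : ℝ) :
    Fin N → HState N → HState N → Matrix (Fin 4) (Fin 4) ℂ :=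
  hubbardAutomaton (fun x y => (if G₁.Adj x y then (t : ℂ) else 0) + (if G₂.Adj x y then (t' : ℂ) else 0))
    (fun _ => (U : ℂ) • siteDouble)

/-- Part 15's identity read as an OPERATOR identity on the enumeration order: the graph word sum IS
`toSpin (hamiltonian G t U)`. -/
theorem hubbardWordSum_eq_toSpin_hamiltonian (G : SimpleGraph (Fin N)) [DecidableRel G.Adj] (t U : ℝ) :
    (∑ k : Fin N, onSite k ((U : ℂ) • siteDouble) -
        ∑ k : Fin N, ∑ k' : Fin N, ∑ σ : Fin 2, if k < k' then
          (if G.Adj k k' then (t : ℂ) else 0) • (productOp (hopFamily k k' σ σ) + productOp (hopFamily k' k σ σ))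
          else 0) = toSpin (hamiltonian G t U) := by
  rw [← automatonKernel_graphAutomaton_eq_toSpin_hamiltonian]
  ext ξ η
  rw [Matrix.of_apply, graphAutomaton, automatonKernel_hubbard_start_fin]

/-- **E1's automaton represents the `t–t′` Hamiltonian.**  The `(START, FINAL)` kernel of `twoGraphAutomaton` is
`toSpin (hamiltonian G₁ t U + hamiltonian G₂ t′ 0)`. -/
theorem automatonKernel_twoGraphAutomaton_eq_toSpin (G₁ G₂ : SimpleGraph (Fin N)) [DecidableRel G₁.Adj]
    [DecidableRel G₂.Adj] (t t' U : ℝ) :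
    (Matrix.of fun ξ η : TensorIndex (Fin N) 4 =>
        automatonKernel N (twoGraphAutomaton G₁ G₂ t t' U) ξ η HState.start HState.fin)
      = toSpin (hamiltonian G₁ t U + hamiltonian G₂ t' 0) := by
  -- the weighted word sum splits along `w = w₁ + w₂`
  have hsplit : (∑ k : Fin N, ∑ k' : Fin N, ∑ σ : Fin 2, if k < k' then
        ((if G₁.Adj k k' then (t : ℂ) else 0) + (if G₂.Adj k k' then (t' : ℂ) else 0)) •
          (productOp (hopFamily k k' σ σ) + productOp (hopFamily k' k σ σ)) else 0) =
      (∑ k : Fin N, ∑ k' : Fin N, ∑ σ : Fin 2, if k < k' then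
        (if G₁.Adj k k' then (t : ℂ) else 0) • (productOp (hopFamily k k' σ σ) + productOp (hopFamily k' k σ σ))
        else 0) +
      ∑ k : Fin N, ∑ k' : Fin N, ∑ σ : Fin 2, if k < k' then
        (if G₂.Adj k k' then (t' : ℂ) else 0) • (productOp (hopFamily k k' σ σ) + productOp (hopFamily k' k σ σ))
        else 0 := by
    rw [← Finset.sum_add_distrib]
    refine Finset.sum_congr rfl fun k _ => ?_
    rw [← Finset.sum_add_distrib]
    refine Finset.sum_congr rfl fun k' _ => ?_
    rw [← Finset.sum_add_distrib]
    refine Finset.sum_congr rfl fun σ _ => ?_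
    by_cases hkk' : k < k'
    · simp only [hkk', if_true, add_smul]
    · simp only [hkk', if_false, add_zero]
  -- no on-site word in the `t′` part
  have h0 : ∑ k : Fin N, onSite k (((0 : ℝ) : ℂ) • siteDouble) = (0 : Op (Fin N) 4) := by
    rw [Complex.ofReal_zero]
    refine Finset.sum_eq_zero fun k _ => ?_
    rw [zero_smul]
    simpa using onSite_sub' k (1 : Matrix (Fin 4) (Fin 4) ℂ) 1
  have hop : (∑ k : Fin N, onSite k ((U : ℂ) • siteDouble) -
      ∑ k : Fin N, ∑ k' : Fin N, ∑ σ : Fin 2, if k < k' then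
        ((if G₁.Adj k k' then (t : ℂ) else 0) + (if G₂.Adj k k' then (t' : ℂ) else 0)) •
          (productOp (hopFamily k k' σ σ) + productOp (hopFamily k' k σ σ)) else 0) =
      toSpin (hamiltonian G₁ t U + hamiltonian G₂ t' 0) := by
    rw [map_add, ← hubbardWordSum_eq_toSpin_hamiltonian G₁ t U, ← hubbardWordSum_eq_toSpin_hamiltonian G₂ t' 0, h0,
      zero_sub, hsplit]
    abel
  ext ξ η
  rw [Matrix.of_apply, twoGraphAutomaton, automatonKernel_hubbard_start_fin, hop]

end TwoGraphs

/-! ## §GH  E1's column-major enumeration is monotone -/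

section ColMajor

/-- E1's enumeration of the open `a × b` box (`hubbard_mpo.py` `rect(…, order="colmajor")`: `x` slow, `y` fast,
site `k = y + b·x`), as a bijection onto `Fin a ×ₗ Fin b`: `k ↦ toLex (k / b, k % b)`. -/
def colMajorEquiv (a b : ℕ) : Fin (a * b) ≃ (Fin a ×ₗ Fin b) := finProdFinEquiv.symm.trans toLex

/-- `(x, y) ↦ y + b·x` is strictly monotone from the Lex order. -/
theorem finProdFin_ofLex_strictMono (a b : ℕ) :
    StrictMono (fun p : Fin a ×ₗ Fin b => (finProdFinEquiv (ofLex p) : Fin (a * b))) := by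
  intro p q hpq
  obtain ⟨x₁, y₁⟩ := p
  obtain ⟨x₂, y₂⟩ := q
  change toLex (x₁, y₁) < toLex (x₂, y₂) at hpq
  rw [Prod.Lex.toLex_lt_toLex] at hpq
  dsimp only at hpq
  change (finProdFinEquiv (x₁, y₁) : Fin (a * b)) < finProdFinEquiv (x₂, y₂)
  rw [Fin.lt_def, finProdFinEquiv_apply_val, finProdFinEquiv_apply_val]
  dsimp only
  rcases hpq with h | ⟨h1, h2⟩
  · have hx : (x₁ : ℕ) + 1 ≤ x₂ := h
    have hy : (y₁ : ℕ) < b := y₁.2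
    calc (y₁ : ℕ) + b * x₁ < b + b * x₁ := by omega
      _ = b * (x₁ + 1) := by ring
      _ ≤ b * x₂ := Nat.mul_le_mul_left b hx
      _ ≤ y₂ + b * x₂ := Nat.le_add_left _ _
  · subst h1
    have h2' : (y₁ : ℕ) < y₂ := h2
    omega

/-- **The column-major enumeration is monotone**: the hypothesis `he` of the box theorems below. -/
theorem colMajorEquiv_lt_iff (a b : ℕ) (i j : Fin (a * b)) :
    colMajorEquiv a b i < colMajorEquiv a b j ↔ i < j := by
  have h := (finProdFin_ofLex_strictMono a b).lt_iff_lt (a := colMajorEquiv a b i) (b := colMajorEquiv a b j)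
  simp only [colMajorEquiv, Equiv.trans_apply, ofLex_toLex, Equiv.apply_symm_apply] at h
  change toLex (finProdFinEquiv.symm i) < toLex (finProdFinEquiv.symm j) ↔ i < j
  exact h.symm

end ColMajor

/-! ## §HH  End to end for the open `t–t′` box read along a monotone enumeration -/

section Box

variable {D : ℕ}

/-- **The multi-state reader encloses the BOX matrix element.**  For the open `a × b` `t–t′` box, a MONOTONE
enumeration `e` (E1's column-major order = the Lex order of `Fin a ×ₗ Fin b`), the pulled-back nearest-neighbour and
diagonal graphs `G₁′, G₂′` on `Fin (a·b)`, the witness tensors `A`, and computed environments over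
`twoGraphAutomaton G₁′ G₂′ t t′ U` with part 12's per-step hypotheses: the number read out of the last `FINAL`
environment is within `(Σ‖r i‖)(Σ‖r′ j‖) · rad FINAL` of
`star Ψ_l ⬝ᵥ (toSpin (hubbardOpenBoxTT' a b t t′ U) *ᵥ Ψ_{l′})`, `Ψ_v k = mpsOpenVar (a·b) A v r(′) (k ∘ e)` — the
consumer's (`Theorems/R2cBoxMpsConsumer`) own operator and vectors. -/
theorem reader_encloses_boxTT'_element (a b : ℕ) (t t' U : ℝ) (e : Fin (a * b) ≃ (Fin a ×ₗ Fin b))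
    (he : ∀ i j, e i < e j ↔ i < j)
    (G₁' G₂' : SimpleGraph (Fin (a * b))) [DecidableRel G₁'.Adj] [DecidableRel G₂'.Adj]
    (hG₁ : ∀ k k', G₁'.Adj k k' ↔ (rectBoxGraph a b).Adj (e k) (e k'))
    (hG₂ : ∀ k k', G₂'.Adj k k' ↔ (rectBoxDiagGraph a b).Adj (e k) (e k'))
    (A : Fin (a * b) → MPSTensor 4 D)
    (κ : Fin (a * b) → ℝ) (hκ0 : ∀ k, 0 ≤ κ k)
    (hκ : ∀ k (z : EuclideanSpace ℂ (Fin D)), ∑ s, ‖toLp 2 (A k s *ᵥ ofLp z)‖ ^ 2 ≤ κ k * ‖z‖ ^ 2)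
    (M : Fin (a * b) → HState (a * b) → HState (a * b) → ℝ) (hM0 : ∀ k b' c, 0 ≤ M k b' c)
    (hMrow : ∀ k b' c s, ∑ s', ‖twoGraphAutomaton G₁' G₂' t t' U k b' c s s'‖ ≤ M k b' c)
    (hMcol : ∀ k b' c s', ∑ s, ‖twoGraphAutomaton G₁' G₂' t t' U k b' c s s'‖ ≤ M k b' c)
    (l l' r r' : Fin D → ℂ) (Yh : Fin (a * b + 1) → HState (a * b) → Matrix (Fin D) (Fin D) ℂ)
    (ρ : Fin (a * b) → HState (a * b) → ℝ)
    (hρ : ∀ (k : Fin (a * b)) (c : HState (a * b)),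
      ‖Yh k.succ c - ∑ b', transferOp (A k) (twoGraphAutomaton G₁' G₂' t t' U k b' c) (Yh k.castSucc b')‖ ≤ ρ k c)
    (rad : Fin (a * b + 1) → HState (a * b) → ℝ)
    (hr0 : ∀ b', ‖Yh 0 b' -
      (Pi.single HState.start (vecMulVec (star l) l') : HState (a * b) → Matrix (Fin D) (Fin D) ℂ) b'‖ ≤ rad 0 b')
    (hr : ∀ (k : Fin (a * b)) (c : HState (a * b)), ∑ b', M k b' c * κ k * rad k.castSucc b' + ρ k c ≤ rad k.succ c) :
    ‖star r ⬝ᵥ (Yh (Fin.last (a * b)) HState.fin *ᵥ r') -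
        star (fun k : TensorIndex (Fin a ×ₗ Fin b) 4 => mpsOpenVar (a * b) A l r (fun i => k (e i))) ⬝ᵥ
          (toSpin (hubbardOpenBoxTT' a b t t' U) *ᵥ
            fun k : TensorIndex (Fin a ×ₗ Fin b) 4 => mpsOpenVar (a * b) A l' r' (fun i => k (e i)))‖ ≤
      (∑ i, ‖r i‖) * (∑ j, ‖r' j‖) * rad (Fin.last (a * b)) HState.fin := by
  have hbox : star (fun k : TensorIndex (Fin a ×ₗ Fin b) 4 => mpsOpenVar (a * b) A l r (fun i => k (e i))) ⬝ᵥ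
        (toSpin (hubbardOpenBoxTT' a b t t' U) *ᵥ
          fun k : TensorIndex (Fin a ×ₗ Fin b) 4 => mpsOpenVar (a * b) A l' r' (fun i => k (e i))) =
      star (mpsOpenVar (a * b) A l r) ⬝ᵥ
        (toSpin (hamiltonian G₁' t U + hamiltonian G₂' t' 0) *ᵥ mpsOpenVar (a * b) A l' r') := by
    rw [hubbardOpenBoxTT', map_add, add_mulVec, dotProduct_add, map_add, add_mulVec, dotProduct_add,
      inner_toSpin_hamiltonian_relabel e he _ G₁' hG₁, inner_toSpin_hamiltonian_relabel e he _ G₂' hG₂]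
  rw [hbox]
  exact reader_encloses_matrix_element (a * b) A (twoGraphAutomaton G₁' G₂' t t' U) κ hκ0 hκ M hM0 hMrow hMcol
    HState.start HState.fin (toSpin (hamiltonian G₁' t U + hamiltonian G₂' t' 0))
    (fun σ τ => by rw [← automatonKernel_twoGraphAutomaton_eq_toSpin G₁' G₂' t t' U, Matrix.of_apply])
    l l' r r' Yh ρ hρ rad hr0 hr

/-- **THE BOX CAPSTONE — bytes ⇒ the consumer's hypothesis `hE`.**  See the module docstring: the `H`-sweep
hypotheses are those of `reader_encloses_boxTT'_element` with `l′ = l`, `r′ = r`; the `Nrm`-sweep hypotheses and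
the by-value ACCEPT test are those of part 17's `certificate_sentence_of_reader`. -/
theorem boxTT'_sentence_of_reader (a b : ℕ) (t t' U : ℝ) (e : Fin (a * b) ≃ (Fin a ×ₗ Fin b))
    (he : ∀ i j, e i < e j ↔ i < j)
    (G₁' G₂' : SimpleGraph (Fin (a * b))) [DecidableRel G₁'.Adj] [DecidableRel G₂'.Adj]
    (hG₁ : ∀ k k', G₁'.Adj k k' ↔ (rectBoxGraph a b).Adj (e k) (e k'))
    (hG₂ : ∀ k k', G₂'.Adj k k' ↔ (rectBoxDiagGraph a b).Adj (e k) (e k'))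
    (A : Fin (a * b) → MPSTensor 4 D) (l r : Fin D → ℂ)
    (κ : Fin (a * b) → ℝ) (hκ0 : ∀ k, 0 ≤ κ k)
    (hκ : ∀ k (z : EuclideanSpace ℂ (Fin D)), ∑ s, ‖toLp 2 (A k s *ᵥ ofLp z)‖ ^ 2 ≤ κ k * ‖z‖ ^ 2)
    -- the `H`-sweep through E1's `t–t′` automaton
    (M : Fin (a * b) → HState (a * b) → HState (a * b) → ℝ) (hM0 : ∀ k b' c, 0 ≤ M k b' c)
    (hMrow : ∀ k b' c s, ∑ s', ‖twoGraphAutomaton G₁' G₂' t t' U k b' c s s'‖ ≤ M k b' c)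
    (hMcol : ∀ k b' c s', ∑ s, ‖twoGraphAutomaton G₁' G₂' t t' U k b' c s s'‖ ≤ M k b' c)
    (YH : Fin (a * b + 1) → HState (a * b) → Matrix (Fin D) (Fin D) ℂ) (ρH : Fin (a * b) → HState (a * b) → ℝ)
    (hρH : ∀ (k : Fin (a * b)) (c : HState (a * b)),
      ‖YH k.succ c - ∑ b', transferOp (A k) (twoGraphAutomaton G₁' G₂' t t' U k b' c) (YH k.castSucc b')‖ ≤ ρH k c)
    (radH : Fin (a * b + 1) → HState (a * b) → ℝ)
    (hrH0 : ∀ b', ‖YH 0 b' -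
      (Pi.single HState.start (vecMulVec (star l) l) : HState (a * b) → Matrix (Fin D) (Fin D) ℂ) b'‖ ≤ radH 0 b')
    (hrH : ∀ (k : Fin (a * b)) (c : HState (a * b)),
      ∑ b', M k b' c * κ k * radH k.castSucc b' + ρH k c ≤ radH k.succ c)
    -- the `Nrm`-sweep (identity words)
    (YN : Fin (a * b + 1) → Matrix (Fin D) (Fin D) ℂ) (ρN : Fin (a * b) → ℝ)
    (hρN : ∀ k : Fin (a * b), ‖YN k.succ - transferOp (A k) 1 (YN k.castSucc)‖ ≤ ρN k)
    (radN : Fin (a * b + 1) → ℝ) (hrN0 : ‖YN 0 - vecMulVec (star l) l‖ ≤ radN 0)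
    (hrN : ∀ k : Fin (a * b), 1 * κ k * radN k.castSucc + ρN k ≤ radN k.succ)
    -- the by-value ACCEPT test on the printed numbers
    (E : ℝ)
    (hlo : (star r ⬝ᵥ (YH (Fin.last (a * b)) HState.fin *ᵥ r)).re +
        (∑ i, ‖r i‖) * (∑ i, ‖r i‖) * radH (Fin.last (a * b)) HState.fin ≤
      E * ((star r ⬝ᵥ (YN (Fin.last (a * b)) *ᵥ r)).re - (∑ i, ‖r i‖) * (∑ i, ‖r i‖) * radN (Fin.last (a * b))))
    (hhi : (star r ⬝ᵥ (YH (Fin.last (a * b)) HState.fin *ᵥ r)).re +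
        (∑ i, ‖r i‖) * (∑ i, ‖r i‖) * radH (Fin.last (a * b)) HState.fin ≤
      E * ((star r ⬝ᵥ (YN (Fin.last (a * b)) *ᵥ r)).re + (∑ i, ‖r i‖) * (∑ i, ‖r i‖) * radN (Fin.last (a * b)))) :
    (star (fun k : TensorIndex (Fin a ×ₗ Fin b) 4 => mpsOpenVar (a * b) A l r (fun i => k (e i))) ⬝ᵥ
        (toSpin (hubbardOpenBoxTT' a b t t' U) *ᵥ
          fun k : TensorIndex (Fin a ×ₗ Fin b) 4 => mpsOpenVar (a * b) A l r (fun i => k (e i)))).re ≤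
      E * (star (fun k : TensorIndex (Fin a ×ₗ Fin b) 4 => mpsOpenVar (a * b) A l r (fun i => k (e i))) ⬝ᵥ
        fun k : TensorIndex (Fin a ×ₗ Fin b) 4 => mpsOpenVar (a * b) A l r (fun i => k (e i))).re := by
  -- the `H`-number is enclosed (this file)
  have hH := reader_encloses_boxTT'_element a b t t' U e he G₁' G₂' hG₁ hG₂ A κ hκ0 hκ M hM0 hMrow hMcol l l r r
    YH ρH hρH radH hrH0 hrH
  -- the `Nrm`-number is enclosed (part 12, one state, identity words); the norm is relabelling-invariant (part 10)
  have hNrm := reader_encloses_productOp_element (a * b) A (fun _ => (1 : Matrix (Fin 4) (Fin 4) ℂ)) κ hκ0 hκ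
    (fun _ => (1 : ℝ)) (fun _ => zero_le_one) (fun _ s => (sum_norm_one_apply_row s).le)
    (fun _ s' => (sum_norm_one_apply_col s').le) (1 : Op (Fin (a * b)) 4) one_apply_eq_prod_one l l r r YN ρN
    hρN radN hrN0 hrN
  rw [Matrix.one_mulVec, ← star_compEquiv_dotProduct e] at hNrm
  -- real parts, then part 3's by-value soundness with `den = 1`
  have hA := abs_re_sub_re_le_of_norm_sub_le hH
  have hB := abs_re_sub_re_le_of_norm_sub_le hNrm
  rw [← one_mul ((star (fun k : TensorIndex (Fin a ×ₗ Fin b) 4 => mpsOpenVar (a * b) A l r (fun i => k (e i))) ⬝ᵥ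
    (toSpin (hubbardOpenBoxTT' a b t t' U) *ᵥ
      fun k : TensorIndex (Fin a ×ₗ Fin b) 4 => mpsOpenVar (a * b) A l r (fun i => k (e i)))).re)] at hA
  rw [← one_mul E] at hlo hhi
  exact accept_sound one_pos hB hA hlo hhi

end Box

end Summit.Ventures.CertifiedManyBodySolver.Upper.IntervalReader

end
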